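import Summits.HodgeConjecture.CorCM.CyclicSexticFaces
import Literature.NumberTheory.ComplexMultiplication.CMGaloisSubfield
import Literature.NumberTheory.ComplexMultiplication.InducedCMType
import HarnessLib

/-!
# CM types of a Galois SEXTIC CM field, III: the imaginary quadratic subfield and induced types

HONEST FRAMING (cell `pub-hodgecm2` / COR-CM, seat b24 gen 8; COUNT-NEUTRAL — no binder row of
`HOME/BINDER-OWNERS.md` is touched): the bridge from the corner pattern of `CyclicSexticFaces.lean` (FINDING F-6 (a)
of `HOME/pub-hodgecm2-lit-andre-3/PORTFOLIO-lit-andre-3.md`) to the INPUT SHAPE of Shimura's theorem on abelian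
varieties of induced type (`Literature.AlgebraicGeometry.ComplexMultiplication.Shimura1998_Thm3_isogenousPower`,
kernel theorem `thm3_isogenousPower_of_riemann (hR) (h₃)` of the tree; blueprint `A1-BLUEPRINT.md` step L3):
a `σ²`-stable CM type of `K` IS `inducedCMType (algebraMap k K) Φ₀` for a CM type `Φ₀` of the imaginary
quadratic subfield `k = K^{⟨σ²⟩}`, and `k` is a CM field with `[k:ℚ] = 2`.  Pure field theory, everything PROVED;
nothing about abelian varieties or cycles is asserted; no named fact; axioms `propext`, `Classical.choice`,
`Quot.sound`.

Let `K` be a CM number field, Galois over `ℚ`, `[K:ℚ] = 6`, `σ ∈ Gal(K/ℚ)` of order `6` with `σ³ = ρ`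
(`CyclicSexticCMTypes.exists_generator`), and `k := IntermediateField.fixedField (Subgroup.zpowers (σ ^ 2))`
(written out in every statement; no new definition).

* §1 `orderOf_sq` (`σ²` has order `3`), `finrank_fixedField_sq_top` (`[K:k] = 3`), **`finrank_fixedField_sq`**
  (`[k:ℚ] = 2`), `conjGal_not_mem_zpowers_sq` (`ρ ∉ ⟨σ²⟩`), **`isCMField_fixedField_sq`** (`k` is a CM field —
  `ρ` moves an element of `k`, `CMGaloisSubfield.isCMField_of_exists_conjGal_apply_ne`), and the general
  **`exists_sq_eq_neg_nat_of_isTotallyComplex`** (a totally complex field of degree `2` contains `δ ∈ 𝓞` with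
  `δ² = -d`, `d ≥ 1`) with its instance `exists_sq_eq_neg_nat_fixedField_sq` (`k = ℚ(√-d)`).
* §2 `exists_pow_sq_of_comp_algebraMap_eq` / `comp_pow_sq_comp_algebraMap` (two embeddings of `K` agree on `k`
  iff they differ by a power of `σ²`: the fibres of `Hom(K, ℂ) → Hom(k, ℂ)` are the `⟨σ²⟩`-orbits),
  `comp_pow_sq_mem_iff`, `mem_iff_mem_of_comp_eq`, and **`exists_inducedCMType_of_sq_stable`**: a CM type `Φ`
  with `Φ ∘ σ² = Φ` equals `inducedCMType (algebraMap k K) Φ₀` (Streng Def. I.3.2) for the CM type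
  `Φ₀ = {φ|_k : φ ∈ Φ}` of `k`; **`face_exists_induced_corner`**: every rank-four face of `K` has a corner induced
  from `k` (whose CM abelian variety is therefore `~ E³`, `E` the CM elliptic curve of type `Φ₀`, by Shimura's
  theorem — not invoked here), all other corners being primitive (`face_corner_pattern`).

## References
* [Shimura1998] G. Shimura, *Abelian Varieties with Complex Multiplication and Modular Functions* (1998), §8.2
  (CM types induced from a subfield; Thm. 3 of §8.2 via `ShimuraInflation.lean`).
* [Streng2010] M. Streng, *Complex multiplication of abelian surfaces* (2010), Ch. I Def. 3.2 (induced CM type),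
  Lemma 2.2 (d) (subfields of CM fields), as typed in `InducedCMType.lean` / `CMGaloisSubfield.lean`.
* [Dodson1984] B. Dodson, Trans. AMS 283 (1984), §5.1.3 Prop. 1 (`n = 3`, `v = 1`: the imaginary quadratic
  subfield and the two degenerate types).
-/

noncomputable section

namespace Summit.HodgeConjecture.CorCM.CyclicSextic

open NumberField NumberField.ComplexEmbedding
open Literature.AlgebraicGeometry.Motives (CMType)
open Literature.NumberTheory.ComplexMultiplication (conjGal inducedCMType mem_inducedCMType_iff)
open Literature.NumberTheory.ComplexMultiplication.CMTypeOps
open Literature.NumberTheory.Automorphic.PicardCM.CMCode (cmTypeMap mem_cmTypeMap_iff)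
open Polynomial

variable {K : Type} [Field K] [NumberField K] [IsCMField K] [IsGalois ℚ K]

/-! ## 1. The imaginary quadratic subfield `k = K^{⟨σ²⟩}` -/

section Quadratic

variable (σ : K ≃ₐ[ℚ] K)

omit [IsCMField K] [IsGalois ℚ K] in
/-- `σ²` has order `3`. [folklore] -/
theorem orderOf_sq (hσ : orderOf σ = 6) : orderOf (σ ^ 2) = 3 := by
  haveI : Fact (Nat.Prime 3) := ⟨by norm_num⟩
  refine orderOf_eq_prime ?_ ?_
  · rw [← pow_mul, show 2 * 3 = orderOf σ by rw [hσ], pow_orderOf_eq_one]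
  · exact pow_ne_one_of_lt_orderOf (by norm_num) (by rw [hσ]; norm_num)

omit [IsCMField K] [IsGalois ℚ K] in
/-- `[K : k] = 3` for `k = K^{⟨σ²⟩}`. [folklore] -/
theorem finrank_fixedField_sq_top (hσ : orderOf σ = 6) :
    Module.finrank (IntermediateField.fixedField (Subgroup.zpowers (σ ^ 2))) K = 3 := by
  rw [IntermediateField.finrank_fixedField_eq_card, Nat.card_zpowers, orderOf_sq σ hσ]

omit [IsCMField K] [IsGalois ℚ K] in
/-- **`[k : ℚ] = 2`**: the fixed field of `⟨σ²⟩` is a quadratic field. [folklore] -/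
theorem finrank_fixedField_sq (h6 : Module.finrank ℚ K = 6) (hσ : orderOf σ = 6) :
    Module.finrank ℚ (IntermediateField.fixedField (Subgroup.zpowers (σ ^ 2))) = 2 := by
  have h := Module.finrank_mul_finrank ℚ (IntermediateField.fixedField (Subgroup.zpowers (σ ^ 2))) K
  rw [finrank_fixedField_sq_top σ hσ, h6] at h
  omega

omit [IsGalois ℚ K] in
/-- `ρ = σ³ ∉ ⟨σ²⟩`. [folklore] -/
theorem conjGal_not_mem_zpowers_sq (hσ : orderOf σ = 6) (h3 : σ ^ 3 = conjGal) :
    (conjGal : K ≃ₐ[ℚ] K) ∉ Subgroup.zpowers (σ ^ 2) := by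
  intro h
  rw [← h3, ← mem_powers_iff_mem_zpowers] at h
  obtain ⟨n, hn⟩ := h
  dsimp only at hn
  rw [← pow_mul] at hn
  have h' := pow_inj_mod.mp hn
  rw [hσ] at h'
  omega

/-- **`k = K^{⟨σ²⟩}` is a CM field** (imaginary quadratic): `ρ ∉ ⟨σ²⟩ = Gal(K/k)` moves some element of `k`
(`CMGaloisSubfield.isCMField_of_exists_conjGal_apply_ne`). [folklore] -/
theorem isCMField_fixedField_sq (hσ : orderOf σ = 6) (h3 : σ ^ 3 = conjGal) :
    IsCMField (IntermediateField.fixedField (Subgroup.zpowers (σ ^ 2))) := by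
  apply Literature.NumberTheory.ComplexMultiplication.isCMField_of_exists_conjGal_apply_ne
  by_contra hne
  push Not at hne
  apply conjGal_not_mem_zpowers_sq σ hσ h3
  rw [← IntermediateField.fixingSubgroup_fixedField (Subgroup.zpowers (σ ^ 2)),
    IntermediateField.mem_fixingSubgroup_iff]
  exact hne

omit [NumberField K] [IsCMField K] [IsGalois ℚ K] in
/-- **An imaginary quadratic field contains an integer square root of a negative integer**: for a totally
complex number field `k` with `[k:ℚ] = 2` there are `δ ∈ 𝓞_k` and `d ≥ 1` with `δ² = -d` (so `k = ℚ(√-d)`).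
Proof: any `x ∈ k` moved by complex conjugation under an embedding `φ` has a quadratic minimal polynomial
`X² + bX + c`; `δ₀ = 2x + b` has `δ₀² = b² - 4c ∈ ℚ` and `φ(δ₀) ∉ ℝ`, so `b² - 4c < 0`; clear denominators.
[folklore] -/
theorem exists_sq_eq_neg_nat_of_isTotallyComplex (k : Type*) [Field k] [NumberField k] [IsTotallyComplex k]
    (h2 : Module.finrank ℚ k = 2) :
    ∃ (δ : 𝓞 k) (d : ℕ), 0 < d ∧ ((δ : k)) ^ 2 = -(d : k) := by
  classical
  obtain ⟨φ⟩ : Nonempty (k →+* ℂ) := inferInstance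
  -- an element moved by complex conjugation under `φ`
  have hnr : ¬ ComplexEmbedding.IsReal φ := IsTotallyComplex.complexEmbedding_not_isReal φ
  rw [ComplexEmbedding.isReal_iff] at hnr
  obtain ⟨x, hx⟩ : ∃ x : k, starRingEnd ℂ (φ x) ≠ φ x := by
    by_contra h
    push Not at h
    exact hnr (RingHom.ext fun y => by rw [conjugate_coe_eq]; exact h y)
  -- its minimal polynomial is quadratic
  have hint : IsIntegral ℚ x := Algebra.IsIntegral.isIntegral x
  have hdeg_le : (minpoly ℚ x).natDegree ≤ 2 := h2 ▸ minpoly.natDegree_le x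
  have hdeg_ne_one : (minpoly ℚ x).natDegree ≠ 1 := by
    intro h1
    have hmem : x ∈ (algebraMap ℚ k).range := by
      rw [← minpoly.degree_eq_one_iff, Polynomial.degree_eq_natDegree (minpoly.ne_zero hint), h1]
      rfl
    obtain ⟨q, rfl⟩ := hmem
    apply hx
    rw [eq_ratCast, map_ratCast, map_ratCast]
  have hdeg_pos : 0 < (minpoly ℚ x).natDegree := minpoly.natDegree_pos hint
  have hdeg : (minpoly ℚ x).natDegree = 2 := by omega
  -- x² + b x + c = 0
  set b : ℚ := (minpoly ℚ x).coeff 1 with hb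
  set c : ℚ := (minpoly ℚ x).coeff 0 with hc
  have hlead : (minpoly ℚ x).coeff 2 = 1 := by
    have := (minpoly.monic hint).leadingCoeff
    rwa [Polynomial.leadingCoeff, hdeg] at this
  have hrel : x ^ 2 + (b : k) * x + (c : k) = 0 := by
    have h0 : Polynomial.aeval x (minpoly ℚ x) = 0 := minpoly.aeval ℚ x
    rw [Polynomial.aeval_eq_sum_range, hdeg] at h0
    simp only [Finset.sum_range_succ, Finset.sum_range_zero, zero_add, pow_zero, pow_one, hlead,
      one_smul] at h0
    rw [← hc, ← hb, Algebra.smul_def, Algebra.smul_def] at h0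
    simp only [mul_one] at h0
    -- h0 : algebraMap ℚ k c + algebraMap ℚ k b * x + x ^ 2 = 0
    have e1 : (algebraMap ℚ k c) = (c : k) := rfl
    have e2 : (algebraMap ℚ k b) = (b : k) := rfl
    rw [e1, e2] at h0
    linear_combination h0
  -- δ₀ = 2x + b, δ₀² = D := b² - 4c
  set D : ℚ := b ^ 2 - 4 * c with hD
  have hδ₀ : ((2 : k) * x + (b : k)) ^ 2 = ((D : ℚ) : k) := by
    rw [hD]; push_cast; linear_combination (4 : k) * hrel
  -- D < 0 : φ(δ₀) is not real but has real square
  have hz : starRingEnd ℂ (φ ((2 : k) * x + (b : k))) ≠ φ ((2 : k) * x + (b : k)) := by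
    intro h
    apply hx
    rw [map_add, map_mul, map_ratCast, map_ofNat] at h
    rw [map_add, map_mul, map_ratCast, map_ofNat] at h
    exact mul_left_cancel₀ two_ne_zero (add_right_cancel h)
  have hDneg : D < 0 := by
    set z : ℂ := φ ((2 : k) * x + (b : k)) with hzdef
    have hz2 : z ^ 2 = (D : ℂ) := by
      rw [hzdef, ← map_pow, hδ₀, map_ratCast]
    have him : z.im ≠ 0 := fun h0 => hz (Complex.conj_eq_iff_im.mpr h0)
    have hre : z.re = 0 := by
      have h := congrArg Complex.im hz2
      rw [Complex.ratCast_im, pow_two, Complex.mul_im] at h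
      have h' : z.re * z.im = 0 := by linarith
      exact (mul_eq_zero.mp h').resolve_right him
    have h := congrArg Complex.re hz2
    rw [Complex.ratCast_re, pow_two, Complex.mul_re, hre] at h
    have hpos : 0 < z.im * z.im := mul_self_pos.mpr him
    exact_mod_cast (show (D : ℝ) < 0 by linarith)
  -- clear denominators: δ = den · δ₀ has δ² = den² D = den · num = -(den · n)
  obtain ⟨n, hn, hnpos⟩ : ∃ n : ℕ, D.num = -(n : ℤ) ∧ 0 < n := by
    have : D.num < 0 := Rat.num_neg.mpr hDneg
    exact ⟨(-D.num).toNat, by omega, by omega⟩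
  have hq : ((D.den : ℚ)) ^ 2 * D = -((D.den * n : ℕ) : ℚ) := by
    have h1 : D * D.den = D.num := Rat.mul_den_eq_num D
    rw [hn] at h1
    push_cast at h1 ⊢
    linear_combination (D.den : ℚ) * h1
  set δ : k := (D.den : k) * ((2 : k) * x + (b : k)) with hδdef
  have hδsq : δ ^ 2 = -((D.den * n : ℕ) : k) := by
    have hc := congrArg (fun q : ℚ => (q : k)) hq
    push_cast at hc
    rw [hδdef, mul_pow, hδ₀]
    push_cast
    linear_combination hc
  have hδint : IsIntegral ℤ δ := by
    refine ⟨X ^ 2 + C ((D.den * n : ℕ) : ℤ), monic_X_pow_add_C _ two_ne_zero, ?_⟩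
    rw [eval₂_add, eval₂_X_pow, eval₂_C, hδsq]
    push_cast
    ring
  exact ⟨⟨δ, hδint⟩, D.den * n, Nat.mul_pos D.den_pos hnpos, hδsq⟩

/-- Hence `k = K^{⟨σ²⟩}` is an imaginary quadratic field `ℚ(√-d)`: some `δ ∈ 𝓞_k` has `δ² = -d` with `d ≥ 1`
(the endomorphism `ι(δ)` of a CM abelian variety with CM by `k` then satisfies `φ ≫ φ = -(d • 𝟙)`, the shape of
the tree's Weil-type facts, e.g. `Markman2025_weilClasses_algebraic_abelianFourfold`). [folklore] -/
theorem exists_sq_eq_neg_nat_fixedField_sq (h6 : Module.finrank ℚ K = 6) (hσ : orderOf σ = 6)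
    (h3 : σ ^ 3 = conjGal) :
    ∃ (δ : 𝓞 (IntermediateField.fixedField (Subgroup.zpowers (σ ^ 2))))
      (d : ℕ), 0 < d ∧ ((δ : IntermediateField.fixedField (Subgroup.zpowers (σ ^ 2)))) ^ 2 = -(d : _) := by
  haveI := isCMField_fixedField_sq σ hσ h3
  exact exists_sq_eq_neg_nat_of_isTotallyComplex _ (finrank_fixedField_sq σ h6 hσ)

end Quadratic

/-! ## 2. `σ²`-stable CM types are induced from `k` -/

section Induced

variable (σ : K ≃ₐ[ℚ] K)

omit [IsCMField K] in
/-- **Fibres of restriction to `k`.** Two complex embeddings of `K` with the same restriction to `k = K^{⟨σ²⟩}`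
differ by a power of `σ²` (`K/ℚ` Galois: `ψ = φ ∘ g` for a unique `g`, which fixes `k` pointwise, so
`g ∈ Gal(K/k) = ⟨σ²⟩` by the Galois correspondence). [folklore] -/
theorem exists_pow_sq_of_comp_algebraMap_eq (φ ψ : K →+* ℂ)
    (h : φ.comp (algebraMap (IntermediateField.fixedField (Subgroup.zpowers (σ ^ 2))) K) =
      ψ.comp (algebraMap (IntermediateField.fixedField (Subgroup.zpowers (σ ^ 2))) K)) :
    ∃ n : ℕ, ψ = φ.comp ((σ ^ 2) ^ n).toRingEquiv.toRingHom := by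
  obtain ⟨g, hg⟩ := (AndreProductForm.comp_gal_bijective K φ).2 ψ
  have hgfix : g ∈ IntermediateField.fixingSubgroup (IntermediateField.fixedField (Subgroup.zpowers (σ ^ 2))) := by
    rw [IntermediateField.mem_fixingSubgroup_iff]
    intro x hx
    apply φ.injective
    have h1 := RingHom.congr_fun h ⟨x, hx⟩
    have h2 := RingHom.congr_fun hg x
    simp only [RingHom.coe_comp, Function.comp_apply] at h1 h2
    rw [IntermediateField.algebraMap_apply] at h1
    change φ (g x) = ψ x at h2
    rw [h2, ← h1]
  rw [IntermediateField.fixingSubgroup_fixedField, ← mem_powers_iff_mem_zpowers] at hgfix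
  obtain ⟨n, hn⟩ := hgfix
  dsimp only at hn
  exact ⟨n, by rw [hn]; exact hg.symm⟩

omit [IsCMField K] [IsGalois ℚ K] in
/-- The powers of `σ²` fix `k = K^{⟨σ²⟩}` pointwise. [folklore] -/
theorem pow_sq_apply_of_mem (n : ℕ) {x : K}
    (hx : x ∈ IntermediateField.fixedField (Subgroup.zpowers (σ ^ 2))) : ((σ ^ 2) ^ n) x = x :=
  (IntermediateField.mem_fixedField_iff _ x).mp hx _ (Subgroup.npow_mem_zpowers (σ ^ 2) n)

omit [IsCMField K] [IsGalois ℚ K] in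
/-- Conversely, `φ ∘ (σ²)ⁿ` and `φ` have the same restriction to `k`. [folklore] -/
theorem comp_pow_sq_comp_algebraMap (φ : K →+* ℂ) (n : ℕ) :
    (φ.comp ((σ ^ 2) ^ n).toRingEquiv.toRingHom).comp
        (algebraMap (IntermediateField.fixedField (Subgroup.zpowers (σ ^ 2))) K) =
      φ.comp (algebraMap (IntermediateField.fixedField (Subgroup.zpowers (σ ^ 2))) K) := by
  refine RingHom.ext fun x => ?_
  simp only [RingHom.coe_comp, Function.comp_apply, IntermediateField.algebraMap_apply]
  exact congrArg φ (pow_sq_apply_of_mem σ n x.2)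

omit [IsCMField K] [IsGalois ℚ K] in
/-- A `σ²`-stable CM type is stable under all powers of `σ²`. [folklore] -/
theorem comp_pow_sq_mem_iff (Φ : CMType K) (hΦ : cmTypeMap (σ ^ 2).toRingEquiv Φ = Φ) (m : ℕ)
    (χ : K →+* ℂ) : χ.comp ((σ ^ 2) ^ m).toRingEquiv.toRingHom ∈ Φ.1 ↔ χ ∈ Φ.1 := by
  have hstab1 : ∀ χ : K →+* ℂ, χ.comp (σ ^ 2).toRingEquiv.toRingHom ∈ Φ.1 ↔ χ ∈ Φ.1 := by
    intro χ
    rw [← mem_cmTypeMap_iff (σ ^ 2).toRingEquiv Φ χ, hΦ]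
  induction m generalizing χ with
  | zero =>
    rw [pow_zero]
    exact Iff.of_eq (congrArg (· ∈ Φ.1) (RingHom.ext fun x => rfl))
  | succ m ih =>
    rw [show χ.comp ((σ ^ 2) ^ (m + 1)).toRingEquiv.toRingHom =
        (χ.comp ((σ ^ 2) ^ m).toRingEquiv.toRingHom).comp (σ ^ 2).toRingEquiv.toRingHom from by
      rw [pow_succ]; exact RingHom.ext fun x => rfl, hstab1]
    exact ih χ

omit [IsCMField K] in
/-- Hence a `σ²`-stable CM type contains both or neither of two embeddings with the same restriction to `k`.
[folklore] -/
theorem mem_iff_mem_of_comp_eq (Φ : CMType K) (hΦ : cmTypeMap (σ ^ 2).toRingEquiv Φ = Φ)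
    (φ ψ : K →+* ℂ)
    (h : φ.comp (algebraMap (IntermediateField.fixedField (Subgroup.zpowers (σ ^ 2))) K) =
      ψ.comp (algebraMap (IntermediateField.fixedField (Subgroup.zpowers (σ ^ 2))) K)) :
    φ ∈ Φ.1 ↔ ψ ∈ Φ.1 := by
  obtain ⟨n, rfl⟩ := exists_pow_sq_of_comp_algebraMap_eq σ φ ψ h
  exact (comp_pow_sq_mem_iff σ Φ hΦ n φ).symm

omit [IsCMField K] in
/-- **A `σ²`-stable CM type of `K` is induced from the imaginary quadratic subfield `k = K^{⟨σ²⟩}`**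
(`inducedCMType`, Streng Def. I.3.2): `Φ = {φ | φ|_k ∈ Φ₀}` for a CM type `Φ₀` of `k` — the input shape of
Shimura's theorem on abelian varieties of induced type (`Shimura1998_Thm3_isogenousPower`: `A_Φ ~ A_{Φ₀}^{[K:k]}`).
[cite: Shimura1998, §8.2 (types induced from a subfield)] -/
theorem exists_inducedCMType_of_sq_stable (Φ : CMType K) (hΦ : cmTypeMap (σ ^ 2).toRingEquiv Φ = Φ) :
    ∃ Φ₀ : CMType (IntermediateField.fixedField (Subgroup.zpowers (σ ^ 2))),
      Φ = inducedCMType (algebraMap (IntermediateField.fixedField (Subgroup.zpowers (σ ^ 2))) K) Φ₀ := by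
  set k := IntermediateField.fixedField (Subgroup.zpowers (σ ^ 2)) with hk
  have hfib := mem_iff_mem_of_comp_eq σ Φ hΦ
  let S₀ : Set (k →+* ℂ) := {τ | ∃ φ : K →+* ℂ, φ ∈ Φ.1 ∧ φ.comp (algebraMap k K) = τ}
  have hS₀ : ∀ τ : k →+* ℂ, τ ∈ S₀ ↔ conjugate τ ∉ S₀ := by
    intro τ
    constructor
    · rintro ⟨φ, hφ, rfl⟩ ⟨ψ, hψ, hψτ⟩
      rw [Literature.NumberTheory.ComplexMultiplication.conjugate_comp_ringHom] at hψτ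
      have hc : conjugate φ ∈ Φ.1 := (hfib (conjugate φ) ψ hψτ.symm).mpr hψ
      exact ((Φ.2 φ).mp hφ) hc
    · intro hτ
      have hlift : (ComplexEmbedding.lift K τ).comp (algebraMap k K) = τ :=
        ComplexEmbedding.lift_comp_algebraMap K τ
      by_cases hφ : ComplexEmbedding.lift K τ ∈ Φ.1
      · exact ⟨_, hφ, hlift⟩
      · exfalso
        apply hτ
        refine ⟨conjugate (ComplexEmbedding.lift K τ),
          (Literature.NumberTheory.ComplexMultiplication.CMTypeOps.conjugate_mem_iff_notMem Φ _).mpr hφ, ?_⟩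
        rw [← Literature.NumberTheory.ComplexMultiplication.conjugate_comp_ringHom, hlift]
  refine ⟨⟨S₀, hS₀⟩, Subtype.ext (Set.ext fun φ => ?_)⟩
  change φ ∈ Φ.1 ↔ φ.comp (algebraMap k K) ∈ S₀
  constructor
  · intro hφ; exact ⟨φ, hφ, rfl⟩
  · rintro ⟨ψ, hψ, h⟩
    exact (hfib ψ φ h).mp hψ

/-- **The induced corner of a face.** For every rank-four face of a Galois sextic CM field, one corner is
induced from the imaginary quadratic subfield `k` (its CM abelian variety is isogenous to `E³` for the CM elliptic
curve `E` of type `Φ₀`, by Shimura's theorem), the other three are the `⟨σ²⟩`-orbit of a primitive corner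
(`face_corner_pattern`). [folklore] -/
theorem face_exists_induced_corner (h6 : Module.finrank ℚ K = 6) (hσ : orderOf σ = 6)
    (h3 : σ ^ 3 = conjGal) (f : Face K) :
    ∃ (j₀ : Fin 4) (Φ₀ : CMType (IntermediateField.fixedField (Subgroup.zpowers (σ ^ 2)))),
      f.corner j₀ = inducedCMType (algebraMap (IntermediateField.fixedField (Subgroup.zpowers (σ ^ 2))) K) Φ₀ ∧
      ∀ j, j ≠ j₀ → cmTypeMap (σ ^ 2).toRingEquiv (f.corner j) ≠ f.corner j := by
  obtain ⟨j₀, j₁, j₂, j₃, -, h0, h1, -, -⟩ := face_corner_pattern σ h6 hσ h3 f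
  obtain ⟨Φ₀, hΦ₀⟩ := exists_inducedCMType_of_sq_stable σ (f.corner j₀) h0
  exact ⟨j₀, Φ₀, hΦ₀, h1⟩

end Induced

end Summit.HodgeConjecture.CorCM.CyclicSextic

end
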